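import Summits.ResolutionOfSingularities.ResolutionOfSingularities.Theorems.FrobeniusLadderFRationalResolutionSuspensionNotRegular
import Mathlib.RingTheory.Localization.AtPrime.Basic
import Mathlib.RingTheory.Localization.Ideal
import HarnessLib

/-!
# A hypersurface in a regular ambient is regular at `P` iff its equation avoids `P⁽²⁾`
(crux `FrobeniusLadder.FRationalResolution`, line `Sketch`)

Stub `stub_isRegularLocalRing_quotient_iff` (worker V1) of the skeleton `Sketch` for crux
stmt-ResolutionOfSingularities-15317 (calibration Claim B: the singular locus of the suspension
`Σf = {yz + f = 0}` is `Sing V(f) × {y = z = 0}`). This file is the abstract, Jacobian-free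
regularity criterion for a hypersurface `{g = 0}` at a prime `P` of a domain `S` whose local ring
`S_P` is regular.

* `algebraMap_mem_maximalIdeal_pow_iff` — for any prime `P` and `n : ℕ`:
  `g/1 ∈ (P S_P)ⁿ ↔ ∃ u ∉ P, u g ∈ Pⁿ`, i.e. `(P S_P)ⁿ ∩ S` is the symbolic power `P⁽ⁿ⁾`
  (`(P S_P)ⁿ = Pⁿ S_P` by `Localization.AtPrime.map_eq_maximalIdeal` and `Ideal.map_pow`, then
  Mathlib's `IsLocalization.algebraMap_mem_map_algebraMap_iff`).
* `algebraMap_mem_maximalIdeal_sq_iff` — the case `n = 2`.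
* `stub_isRegularLocalRing_quotient_iff` — the registered stub: for `S` a domain, `S_P` regular
  local and `0 ≠ g ∈ P`, the local ring `S_P/(g)` is regular iff no `u ∉ P` has `u g ∈ P²`.
  (⇐) `g/1 ∈ 𝔪 ∖ 𝔪²`, so Matsumura 14.2 (`IsRegularLocalRing.quotient_span_singleton`, in tree);
  (⇒) otherwise `0 ≠ g/1 ∈ 𝔪²` (`S → S_P` is injective as `S` is a domain) and a regular local
  ring modulo a non-zero element of `𝔪²` is never regular
  (`not_isRegularLocalRing_quotient_of_mem_sq`, Theorems/…SuspensionNotRegular.lean).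

References: H. Matsumura, *Commutative Ring Theory*, CUP 1986, Thm. 14.2–14.3.
-/

-- single-problem summit: the doubled namespace component is forced
set_option linter.dupNamespace false

namespace Summit.ResolutionOfSingularities.ResolutionOfSingularities.Theorems.FRationalResolution

open IsLocalRing Literature.AlgebraicGeometry.Resolution

/-- SYMBOLIC POWERS VIA THE LOCAL RING. For a prime `P` of `S` and `n : ℕ`, the image `g/1` of
`g ∈ S` in `S_P` lies in `(P S_P)ⁿ` iff `u g ∈ Pⁿ` for some `u ∉ P` (i.e. `g ∈ P⁽ⁿ⁾`):
`(P S_P)ⁿ = Pⁿ S_P` (`Localization.AtPrime.map_eq_maximalIdeal`, `Ideal.map_pow`) and membership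
of `g/1` in an extended ideal of a localization is `∃ m ∈ S ∖ P, m g ∈ Pⁿ`
(`IsLocalization.algebraMap_mem_map_algebraMap_iff`). [folklore] -/
theorem algebraMap_mem_maximalIdeal_pow_iff {S : Type} [CommRing S] (P : Ideal S) [P.IsPrime]
    (g : S) (n : ℕ) :
    algebraMap S (Localization.AtPrime P) g ∈ (maximalIdeal (Localization.AtPrime P)) ^ n ↔
      ∃ u : S, u ∉ P ∧ u * g ∈ P ^ n := by
  rw [← Localization.AtPrime.map_eq_maximalIdeal, ← Ideal.map_pow,
    IsLocalization.algebraMap_mem_map_algebraMap_iff P.primeCompl]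
  exact ⟨fun ⟨u, hu, hug⟩ => ⟨u, Ideal.mem_primeCompl_iff.mp hu, hug⟩,
    fun ⟨u, hu, hug⟩ => ⟨u, Ideal.mem_primeCompl_iff.mpr hu, hug⟩⟩

/-- SYMBOLIC SQUARE VIA THE LOCAL RING. For a prime `P` of `S`, `g/1 ∈ (P S_P)²` iff `u g ∈ P²`
for some `u ∉ P` (the case `n = 2` of `algebraMap_mem_maximalIdeal_pow_iff`). [folklore] -/
theorem algebraMap_mem_maximalIdeal_sq_iff {S : Type} [CommRing S] (P : Ideal S) [P.IsPrime]
    (g : S) :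
    algebraMap S (Localization.AtPrime P) g ∈ (maximalIdeal (Localization.AtPrime P)) ^ 2 ↔
      ∃ u : S, u ∉ P ∧ u * g ∈ P ^ 2 :=
  algebraMap_mem_maximalIdeal_pow_iff P g 2

/-- **A HYPERSURFACE IN A REGULAR AMBIENT IS REGULAR AT `P` IFF ITS EQUATION IS NOT IN THE SYMBOLIC
SQUARE `P⁽²⁾ = P² S_P ∩ S`** (stub V1 of line `Sketch`, crux stmt-ResolutionOfSingularities-15317).
`S` a domain, `P` prime with `S_P` regular local, `0 ≠ g ∈ P`: `S_P/(g)` is a regular local ring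
iff there is no `u ∉ P` with `u g ∈ P²`. By `algebraMap_mem_maximalIdeal_sq_iff` the right-hand
side says `g/1 ∉ 𝔪²` (`𝔪 = P S_P`). (⇐) `g/1 ∈ 𝔪 ∖ 𝔪²`, so `S_P/(g)` is regular by Matsumura 14.2
(`IsRegularLocalRing.quotient_span_singleton`). (⇒) if `g/1 ∈ 𝔪²` then, as `g/1 ≠ 0` (`S → S_P`
is injective, `S` being a domain), `S_P/(g/1)` is not regular
(`not_isRegularLocalRing_quotient_of_mem_sq`: the embedding dimension stays `μ(𝔪)` while the
dimension drops by one). [cite: Matsumura1987, Thm. 14.2] -/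
theorem stub_isRegularLocalRing_quotient_iff (S : Type) [CommRing S] [IsDomain S] (P : Ideal S)
    [P.IsPrime] [IsRegularLocalRing (Localization.AtPrime P)] (g : S) (hg : g ∈ P) (hg0 : g ≠ 0) :
    IsRegularLocalRing (Localization.AtPrime P ⧸
        Ideal.span {algebraMap S (Localization.AtPrime P) g}) ↔
      ¬ ∃ u : S, u ∉ P ∧ u * g ∈ P ^ 2 := by
  rw [← algebraMap_mem_maximalIdeal_sq_iff P g]
  -- `g/1 ∈ 𝔪 = P S_P`
  have h1 : algebraMap S (Localization.AtPrime P) g ∈ maximalIdeal (Localization.AtPrime P) :=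
    (IsLocalization.AtPrime.to_map_mem_maximal_iff (Localization.AtPrime P) P g).mpr hg
  -- `g/1 ≠ 0` (`S` is a domain, so `S → S_P` is injective)
  have h0 : algebraMap S (Localization.AtPrime P) g ≠ 0 := by
    intro h
    apply hg0
    refine IsLocalization.injective (Localization.AtPrime P) P.primeCompl_le_nonZeroDivisors ?_
    rw [h, map_zero]
  refine ⟨fun hreg h2 => ?_, fun h2 => ?_⟩
  · -- (⇒) `0 ≠ g/1 ∈ 𝔪²` would make `S_P/(g)` non-regular
    exact not_isRegularLocalRing_quotient_of_mem_sq h2 h0 hreg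
  · -- (⇐) `g/1 ∈ 𝔪 ∖ 𝔪²`: Matsumura 14.2
    exact (IsRegularLocalRing.quotient_span_singleton h1 h2).1

end Summit.ResolutionOfSingularities.ResolutionOfSingularities.Theorems.FRationalResolution
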